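/-
COR-CM (cell pub-hodgecm2, stage 2 of the Hodge ladder) — count-neutral KERNEL COMBINATORICS «index-two descent when the odd coset inverts the subgroup:
dicyclic / twisted-dihedral / generalised-quaternion types» (seat prover-pub-hodgecm2-b23-g41-0, binder prover b23, gen 41; claim QUARTIC-TRANSPORT, CLAIM-ADDENDUM
#1 «INDEX-TWO DESCENT», HOME/INBOX.md l.10136; blanket `Census/IndexTwoDescent*` l.10149).
One bookkeeping definition with body (`invType`) + theorems, on top of parts I/III (`Census/IndexTwoDescent{Dictionary,Blocks}.lean`) BY NAME; no `decide`, no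
certificate, no named fact, no `sorry`; `Interfaces.lean` (C1), every E term, B01, `Transposition/*`, `PortJoin/*` untouched.
HONEST FRAMING: `HC_CM` is NOT proved, here or anywhere in the tree; nothing here is a period, a count of record or a headline.
T5: n/a-class (hypothesis binders: `c ∈ H`, `c` central, `x ∉ H`, `H.index = 2`, the inversion relation `x h x⁻¹ = h⁻¹`); checker: self, 2026-08-23.
-/
import Summits.HodgeConjecture.CorCM.Census.IndexTwoDescentBlocks

/-!
# Index-two descent, VI: when `x` inverts `H` — the swap-twist is inversion (dicyclic, twisted dihedral, generalised quaternion, …)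

In the dicyclic groups `Dic_m = ⟨a, x | a^{2m} = 1, x² = a^m, x a x⁻¹ = a⁻¹⟩` (`c = a^m`; `Q₈, Q₁₆, …` for `m` a power of two), the twisted dihedral groups
`D_{2m}′ = ⟨r, s | r^{2m} = s² = 1, s r s = r⁻¹⟩` (`m` even, `c = r^m`) and more generally whenever the chosen `x ∉ H` INVERTS the index-two subgroup
(`x h x⁻¹ = h⁻¹` for all `h ∈ H`; then `H` is abelian), part III's two twists are explicit:

* `conjPull T = invType T = {h | h⁻¹ ∈ T}` (`conjPull_eq_invType`) and `pushTwist T = invType (T·(x²)⁻¹)` (`pushTwist_eq_invType_rt`), where `invType` (§1) is the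
  inversion image of a CM type of `(H, c)` (again a CM type, `c` central);
* hence base change along `x` reads **`res₀ (Ψ·x⁻¹) = invType (res₁ Ψ)`**, **`res₁ (Ψ·x⁻¹) = invType ((res₀ Ψ)·(x²)⁻¹)`** (`res₀_rt_x_of_inverts`,
  `res₁_rt_x_of_inverts`): on pairs of `H`-types, `x` SWAPS the coordinates, INVERTS both, and shifts the new `1`-coordinate by `x² ∈ H` (`= c` for `Dic_m`,
  `= 1` for `D_{2m}′`) — the «DICYCLIC BLUEPRINT» of `HOME/pub-hodgecm2-b23/TWISTED-COLUMN.md` (pairs of odd-slice / cyclic labels, `x : (ψ₀, ψ₁) ↦ (ψ₁∘inv, ψ₀∘inv + [x²])`).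

## References
* [Pohlmann1968] H. Pohlmann, Algebraic cycles on abelian varieties of complex multiplication type, Ann. of Math. 88 (1968), Thm 1.
-/

namespace Summit.HodgeConjecture.CorCM.Census.IndexTwoDescent

open Finset
open Summit.HodgeConjecture.CorCM.Prior.AllgGroup.RfwfAllgGroup
open Summit.HodgeConjecture.CorCM.Census.BlockParity

noncomputable section

variable {G : Type*} [Group G] [Fintype G] [DecidableEq G] {c : G}
variable {H : Subgroup G} [DecidablePred (· ∈ H)]

/-! ## §1 The inversion image of a CM type of `(H, c)` -/

/-- **The inversion image** `invType T = {h | h⁻¹ ∈ T}` of a CM type of `(H, c)`; again a CM type because `c` is central (`(c h)⁻¹ = h⁻¹ c⁻¹ = c·h⁻¹`, `c² = 1`).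
[folklore] -/
def invType (hcH : c ∈ H) (hcen : ∀ g : G, g * c = c * g) (hc2 : c * c = 1) (T : CMF H ⟨c, hcH⟩) : CMF H ⟨c, hcH⟩ :=
  ⟨univ.filter fun h : H => h⁻¹ ∈ T.1, fun h => by
    simp only [mem_filter, mem_univ, true_and, mul_inv_rev]
    have hcinv : (⟨c, hcH⟩ : H)⁻¹ = ⟨c, hcH⟩ := inv_eq_of_mul_eq_one_right (csub_mul_csub hcH hc2)
    rw [hcinv, csub_comm hcH hcen]
    exact T.2 h⁻¹⟩

/-- Membership in the inversion image. [folklore] -/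
@[simp] theorem mem_invType (hcH : c ∈ H) (hcen : ∀ g : G, g * c = c * g) (hc2 : c * c = 1) (T : CMF H ⟨c, hcH⟩) (h : H) :
    h ∈ (invType hcH hcen hc2 T).1 ↔ h⁻¹ ∈ T.1 := by
  simp [invType]

/-- Inversion is an involution on CM types. [folklore] -/
theorem invType_invType (hcH : c ∈ H) (hcen : ∀ g : G, g * c = c * g) (hc2 : c * c = 1) (T : CMF H ⟨c, hcH⟩) :
    invType hcH hcen hc2 (invType hcH hcen hc2 T) = T := by
  apply Subtype.ext; ext h
  rw [mem_invType, mem_invType, inv_inv]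

/-- Inversion commutes with conjugation: `invType (T·c) = (invType T)·c`. [folklore] -/
theorem invType_rt_self (hcH : c ∈ H) (hcen : ∀ g : G, g * c = c * g) (hc2 : c * c = 1) (T : CMF H ⟨c, hcH⟩) :
    invType hcH hcen hc2 (rt (⟨c, hcH⟩ : H) ⟨c, hcH⟩ T) = rt (⟨c, hcH⟩ : H) ⟨c, hcH⟩ (invType hcH hcen hc2 T) := by
  apply Subtype.ext; ext h
  have hcinv : (⟨c, hcH⟩ : H)⁻¹ = ⟨c, hcH⟩ := inv_eq_of_mul_eq_one_right (csub_mul_csub hcH hc2)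
  rw [mem_invType, mem_rt, mem_rt, mem_invType, mul_inv_rev, hcinv, csub_comm hcH hcen]

/-- Inversion and base change: `invType (T·Q⁻¹) = (invType T)·Q` for `Q ∈ H` and `H` abelian under `x`-inversion (stated with the commutation as hypothesis).
[folklore] -/
theorem invType_rt (hcH : c ∈ H) (hcen : ∀ g : G, g * c = c * g) (hc2 : c * c = 1) (hcomm : ∀ h k : H, h * k = k * h) (Q : H) (T : CMF H ⟨c, hcH⟩) :
    invType hcH hcen hc2 (rt (⟨c, hcH⟩ : H) Q T) = rt (⟨c, hcH⟩ : H) Q⁻¹ (invType hcH hcen hc2 T) := by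
  apply Subtype.ext; ext h
  rw [mem_invType, mem_rt, mem_rt, mem_invType, mul_inv_rev, inv_inv, hcomm]

/-! ## §2 When `x` inverts `H` -/

omit [Fintype G] [DecidableEq G] [DecidablePred (· ∈ H)] in
/-- If `x` inverts `H` then so does `x⁻¹`: `x⁻¹ h x = h⁻¹`. [folklore] -/
theorem inv_conj_eq_inv_of_inverts {x : G} (hinv : ∀ h : H, x * (h : G) * x⁻¹ = (h : G)⁻¹) (h : H) : x⁻¹ * (h : G) * x = (h : G)⁻¹ := by
  have e := hinv h
  -- from x h x⁻¹ = h⁻¹: h = x⁻¹ h⁻¹ x, so x⁻¹ h x = x⁻¹ (x⁻¹ h⁻¹ x)… use: conjugating h⁻¹ gives h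
  have e' : x * (h : G)⁻¹ * x⁻¹ = (h : G) := by
    have := hinv h⁻¹
    simpa using this
  calc x⁻¹ * (h : G) * x = x⁻¹ * (x * (h : G)⁻¹ * x⁻¹) * x := by rw [e']
    _ = (h : G)⁻¹ := by group

omit [Fintype G] [DecidableEq G] [DecidablePred (· ∈ H)] in
/-- If `x` inverts `H` then `H` is abelian. [folklore] -/
theorem comm_of_inverts {x : G} (hinv : ∀ h : H, x * (h : G) * x⁻¹ = (h : G)⁻¹) (h k : H) : h * k = k * h := by
  apply Subtype.ext
  have e := hinv (h * k)
  rw [Subgroup.coe_mul, mul_inv_rev] at e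
  have e2 : x * ((h : G) * k) * x⁻¹ = (x * (h : G) * x⁻¹) * (x * (k : G) * x⁻¹) := by group
  rw [e2, hinv h, hinv k] at e
  -- e : h⁻¹ * k⁻¹ = k⁻¹ * h⁻¹
  have := congrArg (fun g : G => g⁻¹) e
  simp only [mul_inv_rev, inv_inv] at this
  exact this.symm

/-- **`conjPull = invType`** when `x` inverts `H`. [folklore] -/
theorem conjPull_eq_invType (hcH : c ∈ H) (hcen : ∀ g : G, g * c = c * g) (hc2 : c * c = 1) (hH : H.index = 2) {x : G}
    (hinv : ∀ h : H, x * (h : G) * x⁻¹ = (h : G)⁻¹) (T : CMF H ⟨c, hcH⟩) : conjPull hcH hcen hH x T = invType hcH hcen hc2 T := by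
  apply Subtype.ext; ext h
  rw [mem_conjPull, mem_invType]
  have e : (⟨x⁻¹ * (h : G) * x, inv_mul_mul_mem hH x h⟩ : H) = h⁻¹ := Subtype.ext (by simpa using inv_conj_eq_inv_of_inverts hinv h)
  rw [e]

/-- **`pushTwist T = invType (T·(x²)⁻¹)`** when `x` inverts `H` (`x h x = (x h x⁻¹)·x² = h⁻¹·x²`). [folklore] -/
theorem pushTwist_eq_invType_rt (hcH : c ∈ H) (hcen : ∀ g : G, g * c = c * g) (hc2 : c * c = 1) (hH : H.index = 2) {x : G} (hx : x ∉ H)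
    (hinv : ∀ h : H, x * (h : G) * x⁻¹ = (h : G)⁻¹) (T : CMF H ⟨c, hcH⟩) :
    pushTwist hcH hcen hH hx T = invType hcH hcen hc2 (rt (⟨c, hcH⟩ : H) ⟨x * x, mul_self_mem hH x⟩ T) := by
  apply Subtype.ext; ext h
  rw [mem_pushTwist, mem_invType, mem_rt]
  have e : (⟨x * (h : G) * x, mul_mul_mem hH hx h⟩ : H) = h⁻¹ * ⟨x * x, mul_self_mem hH x⟩ := by
    apply Subtype.ext
    simp only [Subgroup.coe_mul, Subgroup.coe_inv]
    calc x * (h : G) * x = (x * (h : G) * x⁻¹) * (x * x) := by group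
      _ = (h : G)⁻¹ * (x * x) := by rw [hinv h]
  rw [e]

/-- **Base change along `x`, `0`-coordinate, inverting case**: `res₀ (Ψ·x⁻¹) = invType (res₁ Ψ)`. [folklore] -/
theorem res₀_rt_x_of_inverts (hcH : c ∈ H) (hcen : ∀ g : G, g * c = c * g) (hc2 : c * c = 1) (hH : H.index = 2) {x : G}
    (hinv : ∀ h : H, x * (h : G) * x⁻¹ = (h : G)⁻¹) (Ψ : CMF G c) :
    res₀ hcH (rt c x Ψ) = invType hcH hcen hc2 (res₁ hcH hcen x Ψ) := by
  rw [res₀_rt_x hcH hcen hH, conjPull_eq_invType hcH hcen hc2 hH hinv]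

/-- **Base change along `x`, `1`-coordinate, inverting case**: `res₁ (Ψ·x⁻¹) = invType ((res₀ Ψ)·(x²)⁻¹)`. [folklore] -/
theorem res₁_rt_x_of_inverts (hcH : c ∈ H) (hcen : ∀ g : G, g * c = c * g) (hc2 : c * c = 1) (hH : H.index = 2) {x : G} (hx : x ∉ H)
    (hinv : ∀ h : H, x * (h : G) * x⁻¹ = (h : G)⁻¹) (Ψ : CMF G c) :
    res₁ hcH hcen x (rt c x Ψ) = invType hcH hcen hc2 (rt (⟨c, hcH⟩ : H) ⟨x * x, mul_self_mem hH x⟩ (res₀ hcH Ψ)) := by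
  rw [res₁_rt_x hcH hcen hH hx, pushTwist_eq_invType_rt hcH hcen hc2 hH hx hinv]

/-- **Twisted dihedral case** (`x² = 1`): `res₁ (Ψ·x⁻¹) = invType (res₀ Ψ)` — a plain swap with inversion. [folklore] -/
theorem res₁_rt_x_of_inverts_of_sq_eq_one (hcH : c ∈ H) (hcen : ∀ g : G, g * c = c * g) (hc2 : c * c = 1) (hH : H.index = 2) {x : G} (hx : x ∉ H)
    (hinv : ∀ h : H, x * (h : G) * x⁻¹ = (h : G)⁻¹) (hx2 : x * x = 1) (Ψ : CMF G c) :
    res₁ hcH hcen x (rt c x Ψ) = invType hcH hcen hc2 (res₀ hcH Ψ) := by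
  rw [res₁_rt_x_of_inverts hcH hcen hc2 hH hx hinv]
  congr 1
  have e : (⟨x * x, mul_self_mem hH x⟩ : H) = 1 := Subtype.ext hx2
  rw [e, rt_one]

/-- **Dicyclic case** (`x² = c`): `res₁ (Ψ·x⁻¹) = invType ((res₀ Ψ)·c) = (invType (res₀ Ψ))·c` — swap, invert, conjugate. [folklore] -/
theorem res₁_rt_x_of_inverts_of_sq_eq (hcH : c ∈ H) (hcen : ∀ g : G, g * c = c * g) (hc2 : c * c = 1) (hH : H.index = 2) {x : G} (hx : x ∉ H)
    (hinv : ∀ h : H, x * (h : G) * x⁻¹ = (h : G)⁻¹) (hx2 : x * x = c) (Ψ : CMF G c) :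
    res₁ hcH hcen x (rt c x Ψ) = rt (⟨c, hcH⟩ : H) ⟨c, hcH⟩ (invType hcH hcen hc2 (res₀ hcH Ψ)) := by
  rw [res₁_rt_x_of_inverts hcH hcen hc2 hH hx hinv, ← invType_rt_self]
  congr 2
  exact Subtype.ext hx2

end

end Summit.HodgeConjecture.CorCM.Census.IndexTwoDescent
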